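import Literature.NumberTheory.Automorphic.UnitaryLatticeTreeDefs            -- ★ `IsVertexLattice`, `IsVertex`, `latticeGraph` (+ `latticeGraph_adj_iff`), `dualLatt` (+ `dualLatt_antitone`), `scaleLattice`, `StdForm.antidiagonal`
import Literature.NumberTheory.Automorphic.UnitaryLatticeTreeTypes           -- ★ `le_dualLatt_of_isVertexLattice`, `scaleLattice_dualLatt_le_of_isVertexLattice` (the vertex sandwich `ϖM^♯ ≤ M ≤ M^♯`)
import Literature.NumberTheory.Automorphic.UnitaryLatticeTreeIsTree          -- ★ `v_det_antidiagonal_three` (`det Φ₃` is a unit)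
import Mathlib.Combinatorics.SimpleGraph.Metric                               -- `SimpleGraph.dist`, `SimpleGraph.Reachable.exists_walk_length_eq_dist`
import HarnessLib

/-!
# Crux `H413`, line LH4 «(D-RAM) FOUR-FRAME» road (sibling line `Cruxes/H413/Lines/F0_P3c_DyRamFourFrame.lean`, STAGE 1a) — unit (i), item **A-2↑**:
# THE AXIS EXPONENT OF A VERTEX IS AT MOST ITS GRAPH DISTANCE TO ANY REACHABLE `P`-STABLE VERTEX (★ tree support file; the PORT of the HOME proof cert
# `F0/P3a/F0P3a-p01/g30/CERT-A2up-AxisExponentLeTreeDistance.v1.F0P3ap01g30.lean` bb6aa0f89aae3169, §P)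

Cell `hodgecm-mathlib` (D-0151), FLOOR 0, crux item H413 = `stmt-HodgeConjecture-24833`, route of record `HCCMUnconditional`; squad F0∕P3c∕LH4, STAGE 1a of the
in-house road under organ (D-RAM) `stub_DyRamCore` (leaf `Cruxes/H413/Lines/F0_P3c_DyadicPaydown.lean` ED. 4 :147, FROZEN); heir LEAD F0P3a-plan (g18) DIRECTIVE
`STAGE1a-DIRECTIVE-DRAM-FourFrame.v1` b9ecbbedecc9c5ae D3∕D7 «LH4-p03 — A-2↑ port»; seat LH4-p03 (g11).  THEOREMS ONLY (no `def`, no instance, no notation, no named-fact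
hypothesis, no `sorry`); imports = ★ Literature + Mathlib + HarnessLib (no `Cruxes/**`); lane `--supports stmt-HodgeConjecture-24833` (count-neutral).

THE OBJECTS (all ★ `Literature.NumberTheory.Automorphic.UnitaryLatticeTree`, rank `N`).  `K` a field with `Valued K ℤᵐ⁰`, `σ : K →+* K` VALUATION-PRESERVING
(`v ∘ σ = v`), `ϖ ∈ K`, `H ∈ M_N(K)` with `det H` a unit; the vertices `M` of ★ `latticeGraph σ ϖ H` are the lattices with `ϖM^♯ ≤ M ≤ M^♯` (★ `IsVertex`), two of them
ADJACENT iff one is strictly contained in the other (★ `latticeGraph_adj_iff`).  For a matrix `P ∈ M_N(K)` (in the road: a frame projection `π_i^{(b)} = f·f^*Φ₃∕N(f)` of the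
SIGSHEET v2 c03c627160493264, token H3 `frameProj`) and `c : ℕ`, the lattice `Λ` is `P`-STABLE AT EXPONENT `c` when `ϖ^c·P·Λ ⊆ Λ`, written here UNFOLDED, exactly as the body
of the sheet token H13 `AxisStable ϖ P Λ c`:
    `Λ.map ((Matrix.toLin' (ϖ ^ c • P)).restrictScalars 𝒪[K]) ≤ Λ`
(so the sibling line's §0 `def AxisStable … := ‹this body›` consumes every statement below by `Iff.rfl` ∕ unfolding; a `Theorems/` proof file declares no `def`).  The AXIS
EXPONENT `c_i(Λ)` of the sheet (v1.4 §2) is the least such `c` — an `IsLeast` binder below, never an `sInf`.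

WHAT IS PROVED (the «≤» half of SIGSHEET v2 §A item A-2 `AxisExponentEqTreeDistance`, rank-free where the ★ API is):
* `map_smul_toLin'_le_iff`            P-1 · pointwise form: `ϖ^c·P·Λ ⊆ Λ ↔ ∀ x ∈ Λ, (ϖ^c P) x ∈ Λ`;
* `map_smul_toLin'_le_mono`           P-2 · monotone in the exponent when `|ϖ| ≤ 1` (so `{c | ϖ^c·P·Λ ⊆ Λ}` is an upper set and `IsLeast` names the axis exponent);
* `smul_mem_of_le_of_isVertex`        P-3 · the vertex sandwich along an inclusion: vertices `M ≤ M′` ⇒ `ϖ·M′ ⊆ M` (★ `le_dualLatt_of_isVertexLattice`, ★ `dualLatt_antitone`,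
                                             ★ `scaleLattice_dualLatt_le_of_isVertexLattice`);
* `map_smul_toLin'_le_succ_of_adj`    P-4 · ONE EDGE COSTS ONE POWER OF `ϖ`: `M ~ M′`, `ϖ^c·P·M′ ⊆ M′ ⇒ ϖ^{c+1}·P·M ⊆ M` (both orientations);
* `map_smul_toLin'_le_length_of_walk` P-5 · induction on walks: `P·N ⊆ N`, `W : M ⇝ N ⇒ ϖ^{|W|}·P·M ⊆ M`;
* `map_smul_toLin'_le_dist_of_reachable` P-6 · `ϖ^{dist(M,N)}·P·M ⊆ M` for a REACHABLE `P`-stable vertex `N` (`SimpleGraph.Reachable.exists_walk_length_eq_dist`);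
* **`axisExponent_le_dist`**          A-2↑ · the least exponent `c₀` of `Λ` is `≤ dist(Λ, M)` for every `P`-stable vertex `M` reachable from `Λ`;
* **`axisExponent_le_dist_antidiagonal`** A-2↑ at `Φ₃ = antidiag(1,1,1)` (`N = 3`, `det Φ₃` a unit by ★ `v_det_antidiagonal_three`), in the sheet's binders.
WHAT IS NOT HERE (named gap «WILD TREE», unit (ii-0) `stub_WildTreeFoundation` of the sibling line): A-2's EQUALITY needs (α) CONNECTIVITY of ★ `latticeGraph σ ϖ Φ₃`
at the wild datum (`SimpleGraph.dist` is `0` on non-reachable pairs) and (β) the lower bound `ϖ^{D−1}·π_i·Λ ⊄ Λ` along geodesics — the tree structure at wildly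
ramified quadratic `𝒪_E` ([Jacobowitz1962] §§9–11), not in the tree today.  Elementary lattice algebra over a valuation ring: nothing printed is asserted.

HONEST LABEL.  Count-neutral: no organ is paid by this file (it is a lemma one layer below `stub_CensusDictionary` ∕ (ii-G) of the sibling line); the verdict of record for
(D-RAM) stays PRINT [LanglandsShelstad1989 Thm. p. 484 ∕ Rogawski1990 Prop. 4.9.1 (a)] ∕ XL; `HC_CM` is proved only modulo the 7 printed citations (2 remaining: hLiu418 =
`stmt-HodgeConjecture-24832`, h413 = `stmt-HodgeConjecture-24833`) until rung 0 closes.  Port author LH4-p03 (g11); HOME cert author F0P3a-p01 (g30).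

## References
* [Serre1980Trees] J.-P. Serre, *Trees* (1980), Ch. II §1.1 (lattices, adjacency and distance in the tree of a discretely valued field).
* [BruhatTits1972] F. Bruhat, J. Tits, *Groupes réductifs sur un corps local I*, Publ. Math. IHÉS 41 (1972), §10 (lattice models of the buildings of classical groups).
* [Jacobowitz1962] R. Jacobowitz, *Hermitian forms over local fields*, Amer. J. Math. 84 (1962), §§7–11 (hermitian lattices over ramified quadratic extensions).
-/

set_option autoImplicit false
-- the mandated namespace repeats the single-problem summit's segment (`HodgeConjecture.HodgeConjecture`)
set_option linter.dupNamespace false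

noncomputable section

namespace Summit.HodgeConjecture.HodgeConjecture.Cruxes.H413.F0P3cDyRamAxisExponentLeTreeDistance

open scoped Valued WithZero Matrix MatrixGroups
open Literature.NumberTheory.Automorphic Literature.NumberTheory.Automorphic.HermitianLattice
  Literature.NumberTheory.Automorphic.UnitaryLatticeTree

variable {K : Type*} [Field K] [Valued K ℤᵐ⁰] {N : ℕ}

/-- P-1 · POINTWISE FORM of axis stability (sheet token H13 `AxisStable ϖ P Λ c`, unfolded): `ϖ^c·P·Λ ⊆ Λ ↔ ∀ x ∈ Λ, (ϖ^c P) x ∈ Λ`.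
[cite: Serre1980Trees, II.1.1] -/
theorem map_smul_toLin'_le_iff (ϖ : K) (P : Matrix (Fin N) (Fin N) K) (Λ : Submodule 𝒪[K] (Fin N → K)) (c : ℕ) :
    Λ.map ((Matrix.toLin' (ϖ ^ c • P)).restrictScalars 𝒪[K]) ≤ Λ ↔ ∀ x ∈ Λ, (ϖ ^ c • P) *ᵥ x ∈ Λ := by
  constructor
  · intro h x hx
    exact h (Submodule.mem_map.2 ⟨x, hx, by rw [LinearMap.restrictScalars_apply, Matrix.toLin'_apply]⟩)
  · intro h y hy
    obtain ⟨x, hx, rfl⟩ := Submodule.mem_map.1 hy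
    rw [LinearMap.restrictScalars_apply, Matrix.toLin'_apply]
    exact h x hx

/-- P-2 · MONOTONICITY IN THE EXPONENT (`|ϖ| ≤ 1`): `c ≤ c′`, `ϖ^c·P·Λ ⊆ Λ ⇒ ϖ^{c′}·P·Λ ⊆ Λ` — so `{c | ϖ^c·P·Λ ⊆ Λ}` is an upper set of `ℕ` and its least element
(when non-empty) is the axis exponent `c_i(Λ)` of SIGSHEET v2 §2 (`IsLeast`). [cite: Serre1980Trees, II.1.1] -/
theorem map_smul_toLin'_le_mono {ϖ : K} (hϖ : Valued.v ϖ ≤ 1) (P : Matrix (Fin N) (Fin N) K) (Λ : Submodule 𝒪[K] (Fin N → K)) {c c' : ℕ} (hcc' : c ≤ c')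
    (h : Λ.map ((Matrix.toLin' (ϖ ^ c • P)).restrictScalars 𝒪[K]) ≤ Λ) : Λ.map ((Matrix.toLin' (ϖ ^ c' • P)).restrictScalars 𝒪[K]) ≤ Λ := by
  rw [map_smul_toLin'_le_iff] at h ⊢
  intro x hx
  have hw : Valued.v (ϖ ^ (c' - c)) ≤ 1 := by
    rw [map_pow]
    exact pow_le_one' hϖ _
  have key : (ϖ ^ c' • P) *ᵥ x = (⟨ϖ ^ (c' - c), hw⟩ : 𝒪[K]) • ((ϖ ^ c • P) *ᵥ x) := by
    change _ = ϖ ^ (c' - c) • ((ϖ ^ c • P) *ᵥ x)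
    rw [Matrix.smul_mulVec, Matrix.smul_mulVec, smul_smul, ← pow_add, Nat.sub_add_cancel hcc']
  rw [key]
  exact Λ.smul_mem _ (h x hx)

/-- P-3 · THE VERTEX SANDWICH ALONG AN INCLUSION: for vertices `M ≤ M′` of `(K^N, H)` (`det H` a unit, `σ` valuation-preserving), `ϖ·M′ ⊆ M` — from `M′ ≤ M′^♯ ≤ M^♯`
(★ `le_dualLatt_of_isVertexLattice`, ★ `dualLatt_antitone`) and `ϖM^♯ ≤ M` (★ `scaleLattice_dualLatt_le_of_isVertexLattice`). [cite: BruhatTits1972, §10] -/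
theorem smul_mem_of_le_of_isVertex {σ : K →+* K} (hvσ : ∀ a, Valued.v (σ a) = Valued.v a) {ϖ : K} {H : Matrix (Fin N) (Fin N) K} (hH : IsUnit H.det)
    {M M' : Submodule 𝒪[K] (Fin N → K)} (hM : IsVertex σ ϖ H M) (hM' : IsVertex σ ϖ H M') (hle : M ≤ M') {x : Fin N → K} (hx : x ∈ M') :
    ϖ • x ∈ M := by
  obtain ⟨d, hd⟩ := hM
  obtain ⟨d', hd'⟩ := hM'
  have h1 : M' ≤ dualLatt σ H M' := le_dualLatt_of_isVertexLattice hvσ hd'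
  have h2 : dualLatt σ H M' ≤ dualLatt σ H M := dualLatt_antitone σ H hle
  have h3 : scaleLattice ϖ (dualLatt σ H M) ≤ M := scaleLattice_dualLatt_le_of_isVertexLattice hvσ hH hd
  exact h3 (Submodule.mem_map.2 ⟨x, h2 (h1 hx), rfl⟩)

/-- P-4 · ONE EDGE COSTS ONE POWER OF `ϖ`: for ADJACENT vertices `M ~ M′` of ★ `latticeGraph σ ϖ H` (one strictly inside the other), `ϖ^c·P·M′ ⊆ M′ ⇒ ϖ^{c+1}·P·M ⊆ M`
— in both orientations of the edge, by P-3. [cite: Serre1980Trees, II.1.1] -/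
theorem map_smul_toLin'_le_succ_of_adj {σ : K →+* K} (hvσ : ∀ a, Valued.v (σ a) = Valued.v a) {ϖ : K} {H : Matrix (Fin N) (Fin N) K} (hH : IsUnit H.det)
    (P : Matrix (Fin N) (Fin N) K) {M M' : {M : Submodule 𝒪[K] (Fin N → K) // IsVertex σ ϖ H M}} (hadj : (latticeGraph σ ϖ H).Adj M M') {c : ℕ}
    (h : M'.1.map ((Matrix.toLin' (ϖ ^ c • P)).restrictScalars 𝒪[K]) ≤ M'.1) :
    M.1.map ((Matrix.toLin' (ϖ ^ (c + 1) • P)).restrictScalars 𝒪[K]) ≤ M.1 := by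
  rw [map_smul_toLin'_le_iff] at h ⊢
  rw [latticeGraph_adj_iff] at hadj
  intro x hx
  have key : (ϖ ^ (c + 1) • P) *ᵥ x = ϖ • ((ϖ ^ c • P) *ᵥ x) := by
    rw [Matrix.smul_mulVec, Matrix.smul_mulVec, smul_smul, pow_succ']
  rw [key]
  rcases hadj with hlt | hlt
  · -- `M < M′`: `x ∈ M ⊆ M′`, `(ϖ^c P) x ∈ M′`, and `ϖ·M′ ⊆ M`
    exact smul_mem_of_le_of_isVertex hvσ hH M.2 M'.2 hlt.le (h x (hlt.le hx))
  · -- `M′ < M`: `ϖ x ∈ M′`, `(ϖ^c P)(ϖ x) = ϖ·(ϖ^c P) x ∈ M′ ⊆ M`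
    have hx' : ϖ • x ∈ M'.1 := smul_mem_of_le_of_isVertex hvσ hH M'.2 M.2 hlt.le hx
    have h' := h _ hx'
    rw [Matrix.mulVec_smul] at h'
    exact hlt.le h'

/-- P-5 · INDUCTION ON WALKS: `P·N ⊆ N` and a walk `W : M ⇝ N` in ★ `latticeGraph σ ϖ H` give `ϖ^{|W|}·P·M ⊆ M`. [cite: Serre1980Trees, II.1.1] -/
theorem map_smul_toLin'_le_length_of_walk {σ : K →+* K} (hvσ : ∀ a, Valued.v (σ a) = Valued.v a) {ϖ : K} {H : Matrix (Fin N) (Fin N) K} (hH : IsUnit H.det)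
    (P : Matrix (Fin N) (Fin N) K) {M L : {M : Submodule 𝒪[K] (Fin N → K) // IsVertex σ ϖ H M}} (W : (latticeGraph σ ϖ H).Walk M L)
    (hL : L.1.map ((Matrix.toLin' (ϖ ^ 0 • P)).restrictScalars 𝒪[K]) ≤ L.1) :
    M.1.map ((Matrix.toLin' (ϖ ^ W.length • P)).restrictScalars 𝒪[K]) ≤ M.1 := by
  induction W with
  | nil => rw [SimpleGraph.Walk.length_nil]; exact hL
  | cons hadj W ih =>
      rw [SimpleGraph.Walk.length_cons]
      exact map_smul_toLin'_le_succ_of_adj hvσ hH P hadj (ih hL)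

/-- P-6 · THE DISTANCE BOUND: for a REACHABLE `P`-stable vertex `L`, `ϖ^{dist(M,L)}·P·M ⊆ M` (a walk of length `dist` exists: `SimpleGraph.Reachable.exists_walk_length_eq_dist`).
[cite: Serre1980Trees, II.1.1] -/
theorem map_smul_toLin'_le_dist_of_reachable {σ : K →+* K} (hvσ : ∀ a, Valued.v (σ a) = Valued.v a) {ϖ : K} {H : Matrix (Fin N) (Fin N) K} (hH : IsUnit H.det)
    (P : Matrix (Fin N) (Fin N) K) {M L : {M : Submodule 𝒪[K] (Fin N → K) // IsVertex σ ϖ H M}} (hr : (latticeGraph σ ϖ H).Reachable M L)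
    (hL : L.1.map ((Matrix.toLin' (ϖ ^ 0 • P)).restrictScalars 𝒪[K]) ≤ L.1) :
    M.1.map ((Matrix.toLin' (ϖ ^ (latticeGraph σ ϖ H).dist M L • P)).restrictScalars 𝒪[K]) ≤ M.1 := by
  obtain ⟨W, hW⟩ := hr.exists_walk_length_eq_dist
  rw [← hW]
  exact map_smul_toLin'_le_length_of_walk hvσ hH P W hL

/-- **A-2↑ · THE AXIS EXPONENT IS AT MOST THE GRAPH DISTANCE TO ANY REACHABLE `P`-STABLE VERTEX** (hermitian space `(K^N, H)` with `det H` a unit; `σ` valuation-preserving;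
any matrix `P`): if `c₀` is the least `c` with `ϖ^c·P·Λ ⊆ Λ` (the axis exponent of SIGSHEET v2 §2, as an `IsLeast` binder on the unfolded body of H13 `AxisStable`), then
`c₀ ≤ dist(Λ, M)` for every vertex `M` with `P·M ⊆ M` (`ϖ^0·P·M ⊆ M`) that is reachable from `Λ` in ★ `latticeGraph σ ϖ H`.  This is the «≤» half of SIGSHEET v2 §A A-2
(`c_i(Λ) ≤ d(Λ, B_i)`); the «≥» half and the attainment need the (wild) TREE structure — the named gap «WILD TREE» of the module docstring. [cite: Serre1980Trees, II.1.1] -/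
theorem axisExponent_le_dist {σ : K →+* K} (hvσ : ∀ a, Valued.v (σ a) = Valued.v a) {ϖ : K} {H : Matrix (Fin N) (Fin N) K} (hH : IsUnit H.det)
    (P : Matrix (Fin N) (Fin N) K) {Λ M : Submodule 𝒪[K] (Fin N → K)} (hΛ : IsVertex σ ϖ H Λ) (hM : IsVertex σ ϖ H M)
    {c₀ : ℕ} (hc₀ : IsLeast {c : ℕ | Λ.map ((Matrix.toLin' (ϖ ^ c • P)).restrictScalars 𝒪[K]) ≤ Λ} c₀)
    (hM0 : M.map ((Matrix.toLin' (ϖ ^ 0 • P)).restrictScalars 𝒪[K]) ≤ M)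
    (hr : (latticeGraph σ ϖ H).Reachable ⟨Λ, hΛ⟩ ⟨M, hM⟩) :
    c₀ ≤ (latticeGraph σ ϖ H).dist ⟨Λ, hΛ⟩ ⟨M, hM⟩ :=
  hc₀.2 (map_smul_toLin'_le_dist_of_reachable hvσ hH P hr hM0)

/-- **A-2↑ AT `Φ₃`, IN THE SHEET'S BINDERS** (`N = 3`, `H = Φ₃ = (StdForm.antidiagonal 3).over K`, whose determinant is a unit by ★ `v_det_antidiagonal_three`): under the place
datum's `v ∘ σ = v` alone (no completeness, no finiteness, no frame hypothesis), for every matrix `P` — in the road `P = frameProj σ (f b i) = π_i^{(b)}`, sheet token H3 — every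
vertex `Λ` with least axis exponent `c₀`, and every `P`-stable vertex `M` REACHABLE from `Λ` in ★ `latticeGraph σ ϖ Φ₃`: `c₀ ≤ dist(Λ, M)`. [cite: Serre1980Trees, II.1.1] -/
theorem axisExponent_le_dist_antidiagonal (σ : K →+* K) (ϖ : K) (hvσ : ∀ a, Valued.v (σ a) = Valued.v a) (P : Matrix (Fin 3) (Fin 3) K)
    {Λ M : Submodule 𝒪[K] (Fin 3 → K)} (hΛ : IsVertex σ ϖ ((StdForm.antidiagonal 3).over K) Λ) (hM : IsVertex σ ϖ ((StdForm.antidiagonal 3).over K) M)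
    {c₀ : ℕ} (hc₀ : IsLeast {c : ℕ | Λ.map ((Matrix.toLin' (ϖ ^ c • P)).restrictScalars 𝒪[K]) ≤ Λ} c₀)
    (hM0 : M.map ((Matrix.toLin' (ϖ ^ 0 • P)).restrictScalars 𝒪[K]) ≤ M)
    (hr : (latticeGraph σ ϖ ((StdForm.antidiagonal 3).over K)).Reachable ⟨Λ, hΛ⟩ ⟨M, hM⟩) :
    c₀ ≤ (latticeGraph σ ϖ ((StdForm.antidiagonal 3).over K)).dist ⟨Λ, hΛ⟩ ⟨M, hM⟩ := by
  have hH : IsUnit ((StdForm.antidiagonal 3).over K).det := isUnit_iff_ne_zero.2 fun h0 => by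
    have h1 := v_det_antidiagonal_three (K := K)
    rw [h0, map_zero] at h1
    exact zero_ne_one h1
  exact axisExponent_le_dist hvσ hH P hΛ hM hc₀ hM0 hr

end Summit.HodgeConjecture.HodgeConjecture.Cruxes.H413.F0P3cDyRamAxisExponentLeTreeDistance

end
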